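import Summits.KontsevichZagierPeriods.KontsevichZagierPeriods.Theorems.RootDecompRationalCubeDichotomyNashEtaleLocal
import Summits.KontsevichZagierPeriods.KontsevichZagierPeriods.Theorems.RootDecompRationalCubeDichotomyNashEtaleLocalOne
import Summits.KontsevichZagierPeriods.KontsevichZagierPeriods.Theorems.RootDecompRationalCubeDichotomyPiRationalisationGlue
import Mathlib.RingTheory.AlgebraicIndependent.Basic
import Mathlib.FieldTheory.Separable
import Mathlib.RingTheory.Localization.Integral
import Mathlib.Algebra.CharP.Algebra
import Mathlib.Analysis.Analytic.Uniqueness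
import Mathlib.Analysis.Convex.PathConnected
import Mathlib.LinearAlgebra.Matrix.Determinant.Basic
import Mathlib.RingTheory.MvPowerSeries.Basic
import Mathlib.RingTheory.AlgebraicIndependent.Transcendental
import Mathlib.RingTheory.Unramified.LocalStructure
import Mathlib.RingTheory.Smooth.StandardSmoothCotangent
import Mathlib.RingTheory.Extension.Presentation.Submersive
import Mathlib.LinearAlgebra.Matrix.RowCol
import Mathlib.Algebra.MvPolynomial.PDeriv
import Mathlib.RingTheory.MvPolynomial.Tower
import Mathlib.Analysis.Analytic.Polynomial
import Mathlib.Analysis.Analytic.Constructions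
import Mathlib.Analysis.Analytic.Inverse
import Mathlib.Analysis.Analytic.ChangeOrigin
import Mathlib.Analysis.Calculus.FDeriv.Analytic
import Mathlib.Analysis.Calculus.FDeriv.Mul
import Mathlib.Analysis.Calculus.FDeriv.Prod
import Mathlib.Analysis.Calculus.InverseFunctionTheorem.FDeriv
import Mathlib.Topology.Algebra.Module.FiniteDimension
import Mathlib.LinearAlgebra.Matrix.ToLin
import Mathlib.LinearAlgebra.Determinant
import Literature.NumberTheory.Transcendental.SemialgebraicMapsProofs
import Literature.NumberTheory.Transcendental.SemialgebraicDslope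

/-! # `RootDecompRationalCubeDichotomyNashMultiGenP01` — part 1/16 of the mechanical ≤385-line split of `NashEtaleMultiGen.lean`
(split by the decomp-kz census seat for landing; mathematics unchanged). -/

/-
# NashEtaleMultiGen — lineage `decomp-kz-lens-2`, generation 8
# (lens: structural dichotomy — special vs generic POINTS of the closed cube)

Node attacked: the open support item 31659 `NashEtaleLocal` (route
`RootDecompRationalCubeDichotomy`, decl l.564), the last open input of crux 24903
`PiRationalisation` (`PiRationalisation ⟸ NashEtaleCover ⟸ NashEtaleLocal`, both edges LANDED:
`RungEtale.Etale.piRationalisation_of_nashEtaleCover`, `Rung29430.NashEtaleLocalGlue.nashEtaleCover_of_local`).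

What this file does (all kernel-checked, 0 sorry):

* §1  point-wise / dimension-wise matrices `LocalDataAt n g x₀`, `NashEtaleLocalAt n`
      (`NashEtaleLocal ↔ ∀ n, NashEtaleLocalAt n` by `Iff.rfl`).
* §2  LEVEL 1 split (presentation algebra vs analytic content):
      `NashEtaleLocalAt n ⟸ CollapseAt n ∧ MultiGenAt n`, where
      `MultiGenAt n`  = an étale neighbourhood with ANY number `k` of generators (Artin–Mazur /
                        Jacobian form, ℚ-coefficients) carrying `g` as a rational function, and
      `CollapseAt n`  = k generators ⟹ 1 generator — **PROVED for every `n` in §4c**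
                        (`collapseAt_holds`, Stacks 00UE through Mathlib's
                        `Algebra.IsEtaleAt.exists_isStandardEtale`), so LEVEL 1 is an
                        EQUIVALENCE `NashEtaleLocalAt n ↔ MultiGenAt n` (`nashEtaleLocalAt_iff_multiGenAt`).
      Converse edge `MultiGenData n 1 ⟸ LocalDataAt n` proved (`multiGenData_of_localDataAt`).
* §3  LEVEL 2 split of `MultiGenAt n` by the TRANSCENDENCE DEFECT of the point
      `d(x₀) = n − trdeg_ℚ ℚ(x₀)`:
        d = 0   (`AlgebraicIndependent ℚ x₀`)      — PROVED here, Theorem `localDataAt_of_algebraicIndependent`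
                                                    (even the 1-generator form, no collapse needed);
        d = 1   (`DefectLeOne x₀ ∧ ¬ AlgebraicIndependent ℚ x₀`) — piece `MultiGenDefectOneAt n`
                                                    (ELEMENTARY: DVR `ℚ[x]_(π)` with `π` a regular
                                                    parameter of `ℝ{x − x₀}`, ramification index 1);
        d ≥ 2   (`¬ DefectLeOne x₀`)               — piece `MultiGenSpecialAt n` (residual; for
                                                    the square = the algebraic points,
                                                    `not_defectLeOne_two_iff`).
      `k = 1` collapse is elementary (`multiGenData_one_iff`).
* §4  the generic stratum d = 0 in full: minimal relation `q ∈ ℚ[x][w]` of `g` over the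
      polynomial ring, irreducibility of `q` over `Frac ℚ[x]` by clearing denominators
      (`IsLocalization.integerNormalization`) + the identity principle on a rational box,
      separability in characteristic 0, transport through the injective specialisation
      `ℚ[x] ↪ ℝ, x ↦ x₀` (`IsFractionRing.lift`), whence `∂_w q (x₀, g x₀) ≠ 0` and the landed
      `local_of_simple` finishes.  Also PROVED: a non-zero `ℚ`-Nash germ does not vanish at a
      generic point (`eventually_eq_zero_of_generic`) — so generic germs form a FIELD `K₀`.
* §4b the special strata (d ≥ 1, uniformly) REDUCE — special ⟶ generic + rational — to ONE
      algebraic fact in print, typed here as `EtaleAlgebraicPowerSeries d` (Nagata (44.1) +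
      Swan Thm 2.5, as used by Castro-Jiménez–Popescu–Rond 2018, Lemma 2.2): transversal
      `ℚ`-polynomial coordinates `t_j` = minimal polynomials of the algebraic coordinates over
      the transcendence basis, Taylor coefficients in the field `K₀`, algebraic power series
      over `K₀` at the RATIONAL point `t = 0`.  Glue claim typed (`SpecialStrataViaPowerSeries`),
      not yet built (Lean-XL; needs an analytic-germ → `MvPowerSeries` Taylor morphism).
* §4d (v3) TRANSVERSAL COORDINATES at ANY point — PROVED (`exists_generic_chart`): a transcendence
      basis `x ∘ e` among the coordinates and, for every other coordinate `j`, a polynomial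
      `T_j ∈ ℚ[x_e, x_j]` with `T_j(x₀) = 0`, `∂T_j/∂x_j(x₀) ≠ 0` (point version of §4:
      `exists_simple_relation`, `exists_transversal_poly`) — the `ℚ`-polynomial étale chart
      `(x_e, T)` at `x₀` sending `x₀` to `(generic, 0)` (§3.1 of the glue mechanism).
* §4e (v3) the `ℚ`-NASH IMPLICIT FUNCTION THEOREM — PROVED (`NashImplicit.exists_nash_implicit`):
      a polynomial system `F(x, y) = 0` over `ℚ`, étale at `(x₀, y₀)`, has on a rational box
      `V ∋ x₀` a solution `u` that is `ℚ`-SEMIALGEBRAIC and real-ANALYTIC with `u(x₀) = y₀`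
      (strict derivative of polynomial maps from `pderiv`; inverse function theorem for
      `Ψ = (x, F)`; `OpenPartialHomeomorph.hasFPowerSeriesAt_symm`; graph of `u` on a rational box
      inside the source = semialgebraic by uniqueness).
* §4f (v3) CONSUMER FORM — PROVED (`multiGenData_of_pointData`): `MultiGenData n k g x₀` follows
      from étale POINT data `(y₀, F, A, B)` plus the identification of `g` with `A/B` along every
      local analytic solution; §5c: `SpecialPointData n → MultiGenAt n`, hence
      `NashEtaleLocal ⟸ ∀ n ≥ 1, SpecialPointData n` (`nashEtaleLocal_of_specialPointData`) and
      `PiRationalisation ⟸ EtaleAlgebraicPowerSeries ∧ SpecialPointDataViaPowerSeries`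
      (`piRationalisation_of_fact'`) — the remaining non-formalised input is the FORMAL
      identification only.  Local uniqueness of solutions (`NashImplicit.solutions_eq_near`)
      gives the converse, so `PointDataAt n g x₀ ↔ ∃ k, MultiGenData n k g x₀` and
      `SpecialPointData n ↔ MultiGenAt n ↔ NashEtaleLocalAt n` (`specialPointData_iff_nashEtaleLocalAt`).
* §4g TRANSPORT TO PRODUCT POINTS (v4, PROVED): the chart of §4d is a `ℚ`-polynomial étale map
      (`det_chart_ne_zero`, block-triangular Jacobian), its local inverse is `ℚ`-Nash (§4e,
      `exists_chart_inverse`, `chart_leftInverse_near`), and `MultiGenData` pulls back along it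
      (`multiGenData_transport`); hence `ProductPointMultiGen n ↔ ∀ x₀, NashGermMultiGen n x₀` and
      item 31659 ⟸ `∀ n ≥ 1, ProductPointMultiGen n` (`nashEtaleLocal_of_productPointMultiGen`, §5e):
      piece M is needed ONLY at special PRODUCT points `(s₀, 0)`, `s₀` with algebraically
      independent coordinates — the §3.1 coordinate change of NODE.md is now a THEOREM.
* §5d WORKED EXAMPLE (`pointDataAt_gEx`): point data written down by hand for `g = x·√(1+x)` at the
      special point `0 ∈ ℝ¹` (where the minimal relation is NOT simple), identification by positivity.
* §4c piece C in full generality: the `ℚ[x]`-algebra `S' = ℚ[x][y, z]/(F, z·J − 1)` is standard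
      smooth of relative dimension 0 (Jacobian `J²`, a unit), hence étale; 00UE at the point
      character of `x₀`; the standard-étale generator read back through the point characters
      along the graph of `u` is the one `ℚ`-Nash generator (`Collapse.collapseAt_holds`, ≈ 520 lines,
      the g7 `collapse₁_holds` construction for general `(n, k)`).
* §5  compositions BY NAME down to `NashEtaleLocal`, `NashEtaleCover`, `PiRationalisation`;
      §5b (C proved): `NashEtaleLocal ⟸ (∀ n ≥ 1, MultiGenDefectOneAt n) ∧ (∀ n ≥ 2, MultiGenSpecialAt n)`
      (`nashEtaleLocal_of_strata`; dimension 1 needs no separate input: `multiGenSpecialAt_one`),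
      `NashEtaleLocal ⟸ ∀ n ≥ 1, MultiGenAt n` (`nashEtaleLocal_of_multiGen`), and
      `PiRationalisation ⟸ (∀ d, EtaleAlgebraicPowerSeries d) ∧ SpecialStrataViaPowerSeries`
      (`piRationalisation_of_fact`).

Sources: [BCR1998, §8.1 (Nash functions), Prop. 8.1.8 (implicit-function presentation)];
[Nagata1962, Thm 44.1] and [Swan1998, Thm 2.5] as cited in [galaxy:pdf:5102038967989805800 p.4]
(Castro-Jiménez–Popescu–Rond 2018, "k⟨x⟩ is the henselization of k[x]_(x)"); Stacks Project
Tag 00UE (= Mathlib `Algebra.IsEtaleAt.exists_isStandardEtale`); [Zariski1950] (analytic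
normality of normal local rings).
-/

open Set MvPolynomial Filter Topology
open Literature.NumberTheory.Transcendental (IsSemialgebraicFunOn)
open Literature.ModelTheory.ExponentialFields (IsSemialgebraic isSemialgebraic_setOf_eval_pos
  isSemialgebraic_setOf_eval_ne_zero)

namespace Summit.KontsevichZagierPeriods.RootDecompRationalCubeDichotomy.Rung29430.MultiGen

open Summit.KontsevichZagierPeriods.KontsevichZagierPeriods.Theses.RootDecompRationalCubeDichotomy
  (NashEtaleCover NashEtaleLocal PiRationalisation)
open Summit.KontsevichZagierPeriods.RootDecompRationalCubeDichotomy.Rung29430.NashEtaleLocalGlue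
  (local_of_simple nashEtaleCover_of_nashEtaleLocal nashEtaleLocal_zero)
open Summit.KontsevichZagierPeriods.RootDecompRationalCubeDichotomy.Rung29430.NashEtaleLocalOne
  (analyticOnNhd_aeval_snoc)
open Summit.KontsevichZagierPeriods.RootDecompRationalCubeDichotomy.RungEtale.Etale
  (piRationalisation_of_nashEtaleCover)

noncomputable section

/-! ## §1  The point-wise matrix of `NashEtaleLocal` -/

/-- `LocalDataAt n g x₀`: the conclusion of `NashEtaleLocal` at one point — an open `V ∋ x₀`, a
`ℚ`-Nash function `h` on `V` with a SIMPLE-root relation `F(x, h x) = 0`, `∂_w F(x, h x) ≠ 0`, and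
`g = A(x,h)/B(x,h)` on `V`.  Verbatim the matrix of the route decl. -/
def LocalDataAt (n : ℕ) (g : (Fin n → ℝ) → ℝ) (x₀ : Fin n → ℝ) : Prop :=
  ∃ (V : Set (Fin n → ℝ)) (h : (Fin n → ℝ) → ℝ) (F A B : MvPolynomial (Fin (n + 1)) ℚ),
    IsOpen V ∧ x₀ ∈ V ∧ IsSemialgebraicFunOn ℚ V h ∧ AnalyticOnNhd ℝ h V ∧
    ∀ x ∈ V,
      MvPolynomial.aeval (Fin.snoc x (h x) : Fin (n + 1) → ℝ) F = 0 ∧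
      MvPolynomial.aeval (Fin.snoc x (h x) : Fin (n + 1) → ℝ) (MvPolynomial.pderiv (Fin.last n) F) ≠ 0 ∧
      MvPolynomial.aeval (Fin.snoc x (h x) : Fin (n + 1) → ℝ) B ≠ 0 ∧
      g x = MvPolynomial.aeval (Fin.snoc x (h x) : Fin (n + 1) → ℝ) A /
        MvPolynomial.aeval (Fin.snoc x (h x) : Fin (n + 1) → ℝ) B

/-- `NashEtaleLocal` in one fixed dimension `n`. -/
def NashEtaleLocalAt (n : ℕ) : Prop :=
  ∀ (g : (Fin n → ℝ) → ℝ) (U : Set (Fin n → ℝ)), IsOpen U →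
    Set.pi Set.univ (fun _ : Fin n => Set.Icc (0:ℝ) 1) ⊆ U →
    IsSemialgebraicFunOn ℚ U g → AnalyticOnNhd ℝ g U →
    ∀ x₀ ∈ Set.pi Set.univ (fun _ : Fin n => Set.Icc (0:ℝ) 1), LocalDataAt n g x₀

/-- The route decl is the conjunction over all dimensions (definitional). -/
theorem nashEtaleLocal_iff : NashEtaleLocal ↔ ∀ n, NashEtaleLocalAt n := Iff.rfl

/-- Dimension `0` is settled (landed `nashEtaleLocal_zero`). -/
theorem nashEtaleLocalAt_zero : NashEtaleLocalAt 0 :=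
  fun g U hU hKU hsa han x₀ hx₀ => nashEtaleLocal_zero g U hU hKU hsa han x₀ hx₀

/-! ## §2  LEVEL 1 — many generators (`MultiGenAt`) and the collapse (`CollapseAt`) -/

/-- `MultiGenData n k g x₀`: an étale neighbourhood of `x₀` with `k` generators, in Jacobian
(Artin–Mazur) form with `ℚ`-coefficients: `ℚ`-Nash functions `u₁ … u_k` on an open `V ∋ x₀`,
relations `F₁ … F_k ∈ ℚ[x₁..xₙ, y₁..y_k]` with `Fᵢ(x, u(x)) = 0` on `V` and
`det (∂Fᵢ/∂yⱼ)(x₀, u(x₀)) ≠ 0`, and `g = A(x,u)/B(x,u)` on `V` with `B(x,u(x)) ≠ 0`.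
For `k = 1` this is `LocalDataAt` with the simple-root condition only AT `x₀` (which is enough:
`multiGenData_of_localDataAt`; the other direction is the k = 1 case of `CollapseAt`). -/
def MultiGenData (n k : ℕ) (g : (Fin n → ℝ) → ℝ) (x₀ : Fin n → ℝ) : Prop :=
  ∃ (V : Set (Fin n → ℝ)) (u : Fin k → (Fin n → ℝ) → ℝ) (F : Fin k → MvPolynomial (Fin (n + k)) ℚ)
    (A B : MvPolynomial (Fin (n + k)) ℚ),
    IsOpen V ∧ x₀ ∈ V ∧ (∀ j, IsSemialgebraicFunOn ℚ V (u j)) ∧ (∀ j, AnalyticOnNhd ℝ (u j) V) ∧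
    (∀ x ∈ V, ∀ i, MvPolynomial.aeval (Fin.append x (fun j => u j x) : Fin (n + k) → ℝ) (F i) = 0) ∧
    (Matrix.of fun i j : Fin k =>
        MvPolynomial.aeval (Fin.append x₀ (fun j => u j x₀) : Fin (n + k) → ℝ)
          (MvPolynomial.pderiv (Fin.natAdd n j) (F i))).det ≠ 0 ∧
    (∀ x ∈ V, MvPolynomial.aeval (Fin.append x (fun j => u j x) : Fin (n + k) → ℝ) B ≠ 0 ∧
      g x = MvPolynomial.aeval (Fin.append x (fun j => u j x) : Fin (n + k) → ℝ) A /
        MvPolynomial.aeval (Fin.append x (fun j => u j x) : Fin (n + k) → ℝ) B)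

/-- `MultiGenAt n` (piece M, the analytic content of `NashEtaleLocalAt n`): every `ℚ`-Nash `g`
near the closed cube admits, at every point of the cube, an étale neighbourhood with SOME number
of generators carrying it.  [Artin–Mazur; BCR1998 §8.1; Nagata1962 Thm 44.1 for the algebraic
input "`k⟨x⟩` = henselization of `k[x]_(x)`"]. -/
def MultiGenAt (n : ℕ) : Prop :=
  ∀ (g : (Fin n → ℝ) → ℝ) (U : Set (Fin n → ℝ)), IsOpen U →
    Set.pi Set.univ (fun _ : Fin n => Set.Icc (0:ℝ) 1) ⊆ U →
    IsSemialgebraicFunOn ℚ U g → AnalyticOnNhd ℝ g U →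
    ∀ x₀ ∈ Set.pi Set.univ (fun _ : Fin n => Set.Icc (0:ℝ) 1), ∃ k, MultiGenData n k g x₀

/-- `CollapseAt n` (piece C, pure commutative algebra): a `k`-generator étale neighbourhood
collapses to a `1`-generator one (standard étale form `(ℚ[x][w]_b/(f))` with `f' ` invertible).
THEOREM-IN-PRINT: Stacks 00UE / Mathlib `Algebra.IsEtaleAt.exists_isStandardEtale`; the `n = 1,
k = 2` instance is g7's kernel-checked `collapse₁_holds` (relations `F₁, F₂, y·D − 1`,
Jacobian `D²`). -/
def CollapseAt (n : ℕ) : Prop :=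
  ∀ (g : (Fin n → ℝ) → ℝ) (x₀ : Fin n → ℝ) (k : ℕ), MultiGenData n k g x₀ → LocalDataAt n g x₀

/-- One-tuples appended on the right are `Fin.snoc` (pointwise form used below). -/
theorem append_one_eq_snoc {n : ℕ} (x : Fin n → ℝ) (w : ℝ) :
    (Fin.append x (fun _ : Fin 1 => w) : Fin (n + 1) → ℝ) = Fin.snoc x w :=
  Fin.append_right_eq_snoc x (fun _ : Fin 1 => w)

/-- Auxiliary step `natAdd_zero_eq_last`. [bookkeeping] -/
private theorem natAdd_zero_eq_last (n : ℕ) : Fin.natAdd n (0 : Fin 1) = Fin.last n := by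
  ext; simp

/-- `LocalDataAt ⟹ MultiGenData n 1` (so `MultiGenAt n` asks for LESS than `NashEtaleLocalAt n`). -/
theorem multiGenData_of_localDataAt {n : ℕ} {g : (Fin n → ℝ) → ℝ} {x₀ : Fin n → ℝ}
    (h : LocalDataAt n g x₀) : MultiGenData n 1 g x₀ := by
  obtain ⟨V, h, F, A, B, hV, hx₀, hhs, hha, hF⟩ := h
  refine ⟨V, fun _ => h, fun _ => F, A, B, hV, hx₀, fun _ => hhs, fun _ => hha, ?_, ?_, ?_⟩
  · intro x hx i
    rw [append_one_eq_snoc]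
    exact (hF x hx).1
  · rw [Matrix.det_fin_one, Matrix.of_apply, append_one_eq_snoc, natAdd_zero_eq_last]
    exact (hF x₀ hx₀).2.1
  · intro x hx
    rw [append_one_eq_snoc]
    exact (hF x hx).2.2

/-- Evidence that piece M is weaker than the node: `NashEtaleLocalAt n ⟹ MultiGenAt n`. -/
theorem multiGenAt_of_nashEtaleLocalAt {n : ℕ} (h : NashEtaleLocalAt n) : MultiGenAt n :=
  fun g U hU hKU hsa han x₀ hx₀ => ⟨1, multiGenData_of_localDataAt (h g U hU hKU hsa han x₀ hx₀)⟩

/-- The `k = 1` case of the collapse is elementary: the Jacobian condition AT `x₀` spreads to a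
neighbourhood by continuity, and the shrunken domain stays `ℚ`-semialgebraic because it is cut
out by a polynomial condition on the graph.  (So the content of `CollapseAt n` is `k ≥ 2`.) -/
theorem localDataAt_of_multiGenData_one {n : ℕ} {g : (Fin n → ℝ) → ℝ} {x₀ : Fin n → ℝ}
    (h : MultiGenData n 1 g x₀) : LocalDataAt n g x₀ := by
  obtain ⟨V, u, F, A, B, hV, hx₀, hus, hua, hF, hdet, hAB⟩ := h
  have happ : ∀ x : Fin n → ℝ,
      (Fin.append x (fun j => u j x) : Fin (n + 1) → ℝ) = Fin.snoc x (u 0 x) :=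
    fun x => Fin.append_right_eq_snoc x (fun j => u j x)
  simp only [happ] at hF hdet hAB
  rw [Matrix.det_fin_one, Matrix.of_apply, natAdd_zero_eq_last] at hdet
  have hΦan : AnalyticOnNhd ℝ (fun x => MvPolynomial.aeval (Fin.snoc x (u 0 x) : Fin (n + 1) → ℝ)
      (MvPolynomial.pderiv (Fin.last n) (F 0))) V :=
    analyticOnNhd_aeval_snoc (hua 0) _
  refine ⟨V ∩ (fun x => MvPolynomial.aeval (Fin.snoc x (u 0 x) : Fin (n + 1) → ℝ)
      (MvPolynomial.pderiv (Fin.last n) (F 0))) ⁻¹' {0}ᶜ, u 0, F 0, A, B,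
    hΦan.continuousOn.isOpen_inter_preimage hV isOpen_compl_singleton, ⟨hx₀, hdet⟩, ?_,
    (hua 0).mono Set.inter_subset_left, fun x hx => ⟨hF x hx.1 0, hx.2, hAB x hx.1⟩⟩
  -- semialgebraicity of `u 0` on the shrunken set: its graph is cut out of the old graph by
  -- the polynomial condition `∂_w F ≠ 0`
  have hset : {z : Fin (n + 1) → ℝ | ∃ x ∈ V ∩ (fun x =>
        MvPolynomial.aeval (Fin.snoc x (u 0 x) : Fin (n + 1) → ℝ)
          (MvPolynomial.pderiv (Fin.last n) (F 0))) ⁻¹' {0}ᶜ, z = Fin.snoc x (u 0 x)} =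
      {z : Fin (n + 1) → ℝ | ∃ x ∈ V, z = Fin.snoc x (u 0 x)} ∩
        {z | MvPolynomial.aeval z (MvPolynomial.pderiv (Fin.last n) (F 0)) ≠ 0} := by
    ext z
    constructor
    · rintro ⟨x, ⟨hxV, hxΦ⟩, rfl⟩
      exact ⟨⟨x, hxV, rfl⟩, hxΦ⟩
    · rintro ⟨⟨x, hxV, rfl⟩, hz⟩
      exact ⟨x, ⟨hxV, hz⟩, rfl⟩
  show IsSemialgebraic ℚ _
  rw [hset]
  exact IsSemialgebraic.inter (hus 0) (isSemialgebraic_setOf_eval_ne_zero _)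

/-- Hence `MultiGenData n 1 ↔ LocalDataAt n`. -/
theorem multiGenData_one_iff {n : ℕ} {g : (Fin n → ℝ) → ℝ} {x₀ : Fin n → ℝ} :
    MultiGenData n 1 g x₀ ↔ LocalDataAt n g x₀ :=
  ⟨localDataAt_of_multiGenData_one, multiGenData_of_localDataAt⟩

/-- **LEVEL 1 composition.** `NashEtaleLocalAt n ⟸ CollapseAt n ∧ MultiGenAt n`. -/
theorem nashEtaleLocalAt_of_collapse_of_multiGen {n : ℕ} (hC : CollapseAt n) (hM : MultiGenAt n) :
    NashEtaleLocalAt n := by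
  intro g U hU hKU hsa han x₀ hx₀
  obtain ⟨k, hk⟩ := hM g U hU hKU hsa han x₀ hx₀
  exact hC g x₀ k hk

/-! ## §3  LEVEL 2 — the strata of the cube by transcendence defect -/

/-- Transcendence defect `≤ 1`: dropping ONE coordinate leaves a `ℚ`-algebraically independent
family.  (Defect `0` is `AlgebraicIndependent ℚ x₀` itself.) -/
def DefectLeOne {n : ℕ} (x₀ : Fin n → ℝ) : Prop :=
  ∃ i : Fin n, AlgebraicIndependent ℚ (fun j : {j : Fin n // j ≠ i} => x₀ (j : Fin n))

/-- Defect `0 ⟹` defect `≤ 1` (in positive dimension). -/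
theorem defectLeOne_of_algebraicIndependent {n : ℕ} (hn : 0 < n) {x₀ : Fin n → ℝ}
    (h : AlgebraicIndependent ℚ x₀) : DefectLeOne x₀ :=
  ⟨⟨0, hn⟩, h.comp _ Subtype.val_injective⟩

/-- The special points of the SQUARE: defect `2` (`¬ DefectLeOne`) means exactly that both
coordinates are algebraic — a countable set, dense in `[0,1]²`. -/
theorem not_defectLeOne_two_iff (x₀ : Fin 2 → ℝ) :
    ¬ DefectLeOne x₀ ↔ IsAlgebraic ℚ (x₀ 0) ∧ IsAlgebraic ℚ (x₀ 1) := by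
  have hall : ∀ (i : Fin 2) (a b : {j : Fin 2 // j ≠ i}), a = b := by decide
  have hsub : ∀ i : Fin 2, Subsingleton {j : Fin 2 // j ≠ i} := fun i => ⟨hall i⟩
  have key : ∀ (i k : Fin 2) (hk : k ≠ i),
      (AlgebraicIndependent ℚ (fun j : {j : Fin 2 // j ≠ i} => x₀ (j : Fin 2)) ↔
        Transcendental ℚ (x₀ k)) := fun i k hk => by
    haveI := hsub i
    exact algebraicIndependent_singleton_iff (⟨k, hk⟩ : {j : Fin 2 // j ≠ i})
  have h0 := key 0 1 (by decide)
  have h1 := key 1 0 (by decide)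
  constructor
  · intro h
    by_contra hc
    rcases not_and_or.mp hc with h0' | h1'
    · exact h ⟨1, h1.mpr h0'⟩
    · exact h ⟨0, h0.mpr h1'⟩
  · rintro ⟨ha0, ha1⟩ hd
    rcases Fin.exists_fin_two.mp hd with hi | hi
    · exact (h0.mp hi) ha1
    · exact (h1.mp hi) ha0

/-- Piece M₁ (defect-1 stratum, ELEMENTARY): at a point of the cube whose coordinates satisfy
exactly one algebraic relation over `ℚ`, every `ℚ`-Nash `g` has a multi-generator étale
neighbourhood.  Mechanism (= g7's `n = 1` proof of `NashEtaleLocalAt 1`): the prime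
`𝔭 = ker(ℚ[x] → ℝ)` has height 1, `ℚ[x]_𝔭` is a DVR whose uniformiser `π` is a regular parameter
of `ℝ{x − x₀}` (`∇π(x₀) ≠ 0` by separability of the minimal relation), so `π` stays prime in the
analytic local ring, the ramification index of `ℚ[x]_𝔭[g]` is `1`, the extension is étale, and
Stacks 00UE presents it.  [BCR1998 §8.1; Stacks 00UE; Nagata1962 §44] -/
def MultiGenDefectOneAt (n : ℕ) : Prop :=
  ∀ (g : (Fin n → ℝ) → ℝ) (U : Set (Fin n → ℝ)), IsOpen U →
    Set.pi Set.univ (fun _ : Fin n => Set.Icc (0:ℝ) 1) ⊆ U →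
    IsSemialgebraicFunOn ℚ U g → AnalyticOnNhd ℝ g U →
    ∀ x₀ ∈ Set.pi Set.univ (fun _ : Fin n => Set.Icc (0:ℝ) 1),
      ¬ AlgebraicIndependent ℚ x₀ → DefectLeOne x₀ → ∃ k, MultiGenData n k g x₀

/-- Piece M₂ (defect `≥ 2` stratum — the SPECIAL points; DEEP residual): at a point of the cube
with at least two independent algebraic relations among its coordinates (for `n = 2`: both
coordinates algebraic), every `ℚ`-Nash `g` has a multi-generator étale neighbourhood.
Inputs in print: analytic irreducibility/normality of normal essentially-finite-type local
domains [Zariski1950], "`k⟨x⟩` is the henselization of `k[x]_(x)`" [Nagata1962 Thm 44.1, cited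
galaxy:pdf:5102038967989805800 p.4], standard étale form [Swan1998 Thm 2.5 / Stacks 00UE], and
descent of the coefficient field `ℝ → ℚ` (specialisation of transcendental parameters). -/
def MultiGenSpecialAt (n : ℕ) : Prop :=
  ∀ (g : (Fin n → ℝ) → ℝ) (U : Set (Fin n → ℝ)), IsOpen U →
    Set.pi Set.univ (fun _ : Fin n => Set.Icc (0:ℝ) 1) ⊆ U →
    IsSemialgebraicFunOn ℚ U g → AnalyticOnNhd ℝ g U →
    ∀ x₀ ∈ Set.pi Set.univ (fun _ : Fin n => Set.Icc (0:ℝ) 1),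
      ¬ DefectLeOne x₀ → ∃ k, MultiGenData n k g x₀

/-- Evidence: both strata pieces are weaker than piece M (hence than the node). -/
theorem multiGenDefectOneAt_of_multiGenAt {n : ℕ} (h : MultiGenAt n) : MultiGenDefectOneAt n :=
  fun g U hU hKU hsa han x₀ hx₀ _ _ => h g U hU hKU hsa han x₀ hx₀

/-- Auxiliary step `multiGenSpecialAt_of_multiGenAt`. [bookkeeping] -/
theorem multiGenSpecialAt_of_multiGenAt {n : ℕ} (h : MultiGenAt n) : MultiGenSpecialAt n :=
  fun g U hU hKU hsa han x₀ hx₀ _ => h g U hU hKU hsa han x₀ hx₀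

/-! ## §4  The generic stratum (defect 0) — PROVED

### §4.1  `ℚ[x][w]` versus `ℚ[x, w]` and evaluation -/

/-- `ℚ[x₁..xₙ][w] → ℚ[x₁..xₙ, w]`, `w ↦ X (Fin.last n)`. -/
def fromPoly (n : ℕ) : Polynomial (MvPolynomial (Fin n) ℚ) →ₐ[ℚ] MvPolynomial (Fin (n + 1)) ℚ :=
  Polynomial.aevalTower
    (MvPolynomial.rename Fin.castSucc : MvPolynomial (Fin n) ℚ →ₐ[ℚ] MvPolynomial (Fin (n + 1)) ℚ)
    (X (Fin.last n))

/-- `ℚ[x₁..xₙ, w] → ℚ[x₁..xₙ][w]` (a left inverse of `fromPoly`, see `fromPoly_toPoly`). -/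
def toPoly (n : ℕ) : MvPolynomial (Fin (n + 1)) ℚ →ₐ[ℚ] Polynomial (MvPolynomial (Fin n) ℚ) :=
  MvPolynomial.aeval
    (Fin.snoc (fun i : Fin n => Polynomial.C (X i : MvPolynomial (Fin n) ℚ)) Polynomial.X :
      Fin (n + 1) → Polynomial (MvPolynomial (Fin n) ℚ))

end
end Summit.KontsevichZagierPeriods.RootDecompRationalCubeDichotomy.Rung29430.MultiGen
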